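import Mathlib
import Literature.AlgebraicGeometry.Motives.VarietiesProjectiveSpaceProofs
import Literature.AlgebraicGeometry.Motives.BaseChangeProofs
import Literature.AlgebraicGeometry.Resolution.ComponentGluing
import HarnessLib

/-!
# Stub `stub_projectiveAmbientFibre` (line `strata-split`, crux `EquisingularLift`)

For a local ring `O` with a surjection `π : O → k` onto a field and an integral closed subscheme
`H ⊆ ℙⁿ_k`: the special fibre of `ℙⁿ_O = Proj O[x₀,…,xₙ] → Spec O` is irreducible and contains a
closed subset `Y` whose reduced induced closed subscheme is isomorphic to `H`.
Proof (Liu 2002, Prop. 3.1.9 / Ex. 3.1.10 for the ring map `π`): the square `g : ℙⁿ_k → ℙⁿ_O`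
(`Proj` of `O[x] → k[x]`), structure morphisms, `Spec k → Spec O` is cartesian — checked on the
charts `D₊(s)`, where it is `Spec` of the pushout `O[x]⁰_(s) ⊗_O k ≅ k[x]⁰_(πs)`. Hence `g` is a
closed immersion onto the special fibre, which is therefore irreducible, and for `Y = (ι ≫ g)(H)`
the reduced closed subscheme `V(Y)` is isomorphic to the reduced scheme `H` (same kernel).
-/

set_option linter.dupNamespace false -- mandated namespace of this single-conjunct summit

open CategoryTheory AlgebraicGeometry TopologicalSpace
open MvPolynomial HomogeneousLocalization HomogeneousIdeal TensorProduct
open Literature.AlgebraicGeometry.Motives.ProjBaseChange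

attribute [local instance] MvPolynomial.gradedAlgebra
attribute [local instance] Literature.AlgebraicGeometry.Motives.ProjBaseChange.algebraBase

namespace Summit.ResolutionOfSingularities.ResolutionOfSingularities.Cruxes.EquisingularLift.StrataSplit

namespace ProjectiveAmbientFibre

variable {O k : Type} [CommRing O] [CommRing k] (π : O →+* k)
  {ι : Type} (φ : homogeneousSubmodule ι O →+*ᵍ homogeneousSubmodule ι k)
  (hφ : ∀ p, φ p = MvPolynomial.map π p)

local notation "𝒜" => homogeneousSubmodule ι O
local notation "ℬ" => homogeneousSubmodule ι k

include hφ in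
/-- The irrelevant ideal of `k[xᵢ]` is generated by the image of that of `O[xᵢ]` (both are
generated by the variables): the hypothesis of Mathlib's `Proj.map`.
[cite: Liu2002, Prop. 3.1.9 (proof)] -/
theorem irrelevant_le_map_gradedMap : ℬ₊ ≤ (𝒜₊).map φ := by
  rw [← toIdeal_le_toIdeal_iff, irrelevant_eq_span, Ideal.span_le, toIdeal_map]
  intro x hx
  simp only [Set.mem_iUnion, SetLike.mem_coe, exists_prop] at hx
  obtain ⟨i, hi, hx⟩ := hx
  rw [SetLike.mem_coe, MvPolynomial.as_sum x]
  refine Ideal.sum_mem _ fun m hm ↦ ?_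
  rw [show monomial m (coeff m x) = C (coeff m x) * φ (monomial m 1) by
    rw [hφ, map_monomial, map_one, C_mul_monomial, mul_one]]
  exact Ideal.mul_mem_left _ _ (Ideal.mem_map_of_mem _ (mem_irrelevant_of_mem _ hi
    (isHomogeneous_monomial (R := O) 1 (degree_eq_of_mem_support ι hx hm))))

include hφ in
/-- The base-change map `O[xᵢ]⁰_(s) → k[xᵢ]⁰_(πs)` on homogeneous localizations is compatible
with the structure maps from `O` and `k`. [folklore] -/
theorem awayMap_algebraMap (s : MvPolynomial ι O) (r : O) :
    Away.map φ s (algebraMap O (Away 𝒜 s) r) = algebraMap k (Away ℬ (φ s)) (π r) := by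
  apply val_injective
  rw [val_algebraMap, algebraMap_eq', Away.map, map_mk, val_mk]
  simp only [SetLike.GradeZero.coe_algebraMap, MvPolynomial.algebraMap_eq]
  rw [IsScalarTower.algebraMap_apply k (MvPolynomial ι k) (Localization _),
    ← Localization.mk_algebraMap]
  congr 1
  · simp [hφ, map_C]
  · ext; simp

/-- A homogeneous fraction `x / sⁿ ∈ O[xᵢ]⁰_(s)` all of whose numerator coefficients lie in an
ideal `I ⊆ O` lies in the extension of `I`. [folklore] -/
theorem awayMk_mem_map_of_coeff_mem {d : ℕ} {s : MvPolynomial ι O} (hs : s ∈ 𝒜 d) (I : Ideal O)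
    (n : ℕ) (x : MvPolynomial ι O) (hx : x ∈ 𝒜 (n • d)) (hI : ∀ m, coeff m x ∈ I) :
    Away.mk _ hs n x hx ∈ I.map (algebraMap O (Away 𝒜 s)) := by
  classical
  set M : Set (MvPolynomial ι O) :=
    {p | ∃ (m : ι →₀ ℕ) (o : O), m.degree = n • d ∧ o ∈ I ∧ p = monomial m o}
  have hM : Submodule.span O M ≤ 𝒜 (n • d) := by
    refine Submodule.span_le.mpr ?_
    rintro _ ⟨m, o, hm, -, rfl⟩
    exact isHomogeneous_monomial o hm
  have hxM : x ∈ Submodule.span O M := by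
    rw [MvPolynomial.as_sum x]
    exact Submodule.sum_mem _ fun m hm ↦
      Submodule.subset_span ⟨m, _, degree_eq_of_mem_support ι hx hm, hI m, rfl⟩
  suffices h : ∀ p (hp : p ∈ Submodule.span O M),
      Away.mk _ hs n p (hM hp) ∈ I.map (algebraMap O (Away 𝒜 s)) from h x hxM
  intro p hp
  induction hp using Submodule.span_induction with
  | mem p hp =>
    obtain ⟨m, o, hm, ho, rfl⟩ := hp
    have hmo : Away.mk _ hs n (monomial m o) (isHomogeneous_monomial o hm) =
        algebraMap O _ o * Away.mk _ hs n (monomial m 1) (isHomogeneous_monomial 1 hm) := by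
      apply val_injective
      rw [val_mul, val_algebraMap, Away.val_mk, Away.val_mk,
        IsScalarTower.algebraMap_apply O (MvPolynomial ι O) (Localization _),
        MvPolynomial.algebraMap_eq, ← Localization.mk_algebraMap, Localization.mk_mul, one_mul]
      congr 1
      rw [Algebra.algebraMap_self, RingHom.id_apply, C_mul_monomial, mul_one]
    rw [hmo]
    exact Ideal.mul_mem_right _ _ (Ideal.mem_map_of_mem _ ho)
  | zero =>
    rw [show Away.mk _ hs n (0 : MvPolynomial ι O) (zero_mem _) = 0 from
      val_injective _ (by rw [Away.val_mk, val_zero, Localization.mk_zero])]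
    exact zero_mem _
  | add p q hp hq ihp ihq =>
    rw [show Away.mk _ hs n (p + q) (hM (add_mem hp hq)) =
        Away.mk _ hs n p (hM hp) + Away.mk _ hs n q (hM hq) from val_injective _
      (by rw [val_add, Away.val_mk, Away.val_mk, Away.val_mk, Localization.add_mk_self])]
    exact add_mem ihp ihq
  | smul o p hp ih =>
    have hsmul : Away.mk _ hs n (o • p) (hM (Submodule.smul_mem _ o hp)) =
        algebraMap O _ o * Away.mk _ hs n p (hM hp) := by
      apply val_injective
      rw [val_mul, val_algebraMap, Away.val_mk, Away.val_mk, smul_eq_C_mul,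
        IsScalarTower.algebraMap_apply O (MvPolynomial ι O) (Localization _),
        MvPolynomial.algebraMap_eq, ← Localization.mk_algebraMap, Localization.mk_mul, one_mul]
      rfl
    rw [hsmul]
    exact Ideal.mul_mem_left _ _ ih

include hφ in
/-- The kernel of `O[xᵢ]⁰_(s) → k[xᵢ]⁰_(πs)` is contained in the extension of `ker π`: if
`π(x)/π(s)ⁿ = 0` then `π(sᴺ x) = 0` for some `N`, so `x/sⁿ = sᴺx/sᴺ⁺ⁿ` has all numerator
coefficients in `ker π`. [cite: Liu2002, Prop. 3.1.9 (proof)] -/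
theorem awayMk_mem_map_ker {d : ℕ} {s : MvPolynomial ι O} (hs : s ∈ 𝒜 d) (n : ℕ)
    (x : MvPolynomial ι O) (hx : x ∈ 𝒜 (n • d)) (h0 : Away.map φ s (Away.mk _ hs n x hx) = 0) :
    Away.mk _ hs n x hx ∈ (RingHom.ker π).map (algebraMap O (Away 𝒜 s)) := by
  rw [Away.map_mk] at h0
  have h0' := congrArg HomogeneousLocalization.val h0
  rw [Away.val_mk, val_zero, Localization.mk_eq_mk', IsLocalization.mk'_eq_zero_iff] at h0'
  obtain ⟨⟨_, N, rfl⟩, hN⟩ := h0'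
  have hN' : MvPolynomial.map π (s ^ N * x) = 0 := by
    rw [← hφ, map_mul, map_pow]
    exact hN
  have hsx : s ^ N * x ∈ 𝒜 ((N + n) • d) := by
    rw [add_smul]
    exact SetLike.mul_mem_graded (SetLike.pow_mem_graded N hs) hx
  have heq : Away.mk _ hs n x hx = Away.mk _ hs (N + n) (s ^ N * x) hsx := by
    apply val_injective
    rw [Away.val_mk, Away.val_mk, Localization.mk_eq_mk_iff, Localization.r_iff_exists]
    refine ⟨1, ?_⟩
    simp only [OneMemClass.coe_one, one_mul]
    ring
  rw [heq]
  refine awayMk_mem_map_of_coeff_mem hs _ _ _ hsx fun m ↦ ?_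
  rw [RingHom.mem_ker, ← coeff_map, hN', coeff_zero]

include hφ in
/-- **The chart `D₊(s) ⊆ ℙ_k` is `D₊(s) ×_O k`.** For `s ∈ O[xᵢ]` homogeneous and `π : O → k`
surjective, `O → O[xᵢ]⁰_(s)`, `π`, `O[xᵢ]⁰_(s) → k[xᵢ]⁰_(πs)`, `k → k[xᵢ]⁰_(πs)` is a pushout
square of commutative rings: the comparison map `O[xᵢ]⁰_(s) ⊗_O k → k[xᵢ]⁰_(πs)` is surjective
(monomials come from `O[xᵢ]`, scalars from `k`) and injective (every tensor is `a ⊗ 1`, and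
`a ↦ 0` forces `a ∈ (ker π) O[xᵢ]⁰_(s)`, whence `a ⊗ 1 = 0`). [cite: Liu2002, Prop. 3.1.9 (proof)] -/
theorem isPushout_awayMap (hπ : Function.Surjective π) {d : ℕ} (s : MvPolynomial ι O)
    (hs : s ∈ 𝒜 d) :
    IsPushout (CommRingCat.ofHom (algebraMap O (Away 𝒜 s))) (CommRingCat.ofHom π)
      (CommRingCat.ofHom (Away.map φ s)) (CommRingCat.ofHom (algebraMap k (Away ℬ (φ s)))) := by
  classical
  letI : Algebra O k := π.toAlgebra
  letI : Algebra O (Away ℬ (φ s)) := ((algebraMap k (Away ℬ (φ s))).comp π).toAlgebra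
  haveI : IsScalarTower O k (Away ℬ (φ s)) :=
    IsScalarTower.of_algebraMap_eq (R := O) (S := k) (A := Away ℬ (φ s)) fun _ ↦ rfl
  let ψ : Away 𝒜 s →ₐ[O] Away ℬ (φ s) :=
    { Away.map φ s with commutes' := fun r ↦ awayMap_algebraMap π φ hφ s r }
  let T : Away 𝒜 s ⊗[O] k →ₐ[O] Away ℬ (φ s) :=
    Algebra.TensorProduct.lift ψ (IsScalarTower.toAlgHom O k _) fun _ _ ↦ .all _ _
  have hT : ∀ a c, T (a ⊗ₜ c) = Away.map φ s a * algebraMap k _ c := fun a c ↦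
    Algebra.TensorProduct.lift_tmul ..
  have hFs : φ s ∈ ℬ d := φ.map_mem hs
  -- surjectivity: monomials come from `O[xᵢ]`, scalars from `k`
  have hsurj : Function.Surjective T := by
    intro z
    obtain ⟨n, a, ha, rfl⟩ := Away.mk_surjective ℬ hFs z
    set M : Set (MvPolynomial ι k) := {p | ∃ m : ι →₀ ℕ, m.degree = n • d ∧ p = monomial m 1}
    have hM : Submodule.span k M ≤ ℬ (n • d) := by
      refine Submodule.span_le.mpr ?_
      rintro _ ⟨m, hm, rfl⟩
      exact isHomogeneous_monomial 1 hm
    have haM : a ∈ Submodule.span k M := by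
      rw [MvPolynomial.as_sum a]
      refine Submodule.sum_mem _ fun m hm ↦ ?_
      rw [← mul_one (coeff m a), ← smul_eq_mul, ← smul_monomial]
      exact Submodule.smul_mem _ _
        (Submodule.subset_span ⟨m, degree_eq_of_mem_support ι ha hm, rfl⟩)
    suffices h : ∀ p (hp : p ∈ Submodule.span k M), ∃ y, T y = Away.mk _ hFs n p (hM hp) from
      h a haM
    intro p hp
    induction hp using Submodule.span_induction with
    | mem p hp =>
      obtain ⟨m, hm, rfl⟩ := hp
      refine ⟨Away.mk _ hs n (monomial m 1) (isHomogeneous_monomial 1 hm) ⊗ₜ 1, ?_⟩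
      rw [hT, Away.map_mk, RingHom.map_one, mul_one]
      apply val_injective
      rw [Away.val_mk, Away.val_mk]
      congr 1
      rw [hφ, map_monomial, map_one]
    | zero =>
      refine ⟨0, ?_⟩
      rw [map_zero]
      exact val_injective _ (by rw [Away.val_mk, val_zero, Localization.mk_zero])
    | add p q hp hq ihp ihq =>
      obtain ⟨y, hy⟩ := ihp
      obtain ⟨y', hy'⟩ := ihq
      refine ⟨y + y', ?_⟩
      rw [map_add, hy, hy']
      exact val_injective _
        (by rw [val_add, Away.val_mk, Away.val_mk, Away.val_mk, Localization.add_mk_self])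
    | smul c p hp ih =>
      obtain ⟨y, hy⟩ := ih
      refine ⟨(1 ⊗ₜ c) * y, ?_⟩
      rw [map_mul, hy, hT, RingHom.map_one, one_mul]
      apply val_injective
      rw [val_mul, val_algebraMap, Away.val_mk, Away.val_mk, smul_eq_C_mul,
        IsScalarTower.algebraMap_apply k (MvPolynomial ι k) (Localization _),
        MvPolynomial.algebraMap_eq, ← Localization.mk_algebraMap, Localization.mk_mul]
      congr 1
      exact one_mul _
  -- injectivity: every tensor is `a ⊗ 1`, and the kernel of `Away.map` is generated by `ker π`
  have hinj : Function.Injective T := by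
    rw [injective_iff_map_eq_zero]
    intro z hz
    obtain ⟨a, rfl⟩ : ∃ a, a ⊗ₜ[O] (1 : k) = z := by
      clear hz
      induction z using TensorProduct.induction_on with
      | zero => exact ⟨0, zero_tmul _ _⟩
      | tmul a c =>
        obtain ⟨o, rfl⟩ := hπ c
        refine ⟨o • a, ?_⟩
        rw [smul_tmul, Algebra.smul_def, mul_one]
        rfl
      | add x y hx hy =>
        obtain ⟨a, rfl⟩ := hx
        obtain ⟨b, rfl⟩ := hy
        exact ⟨a + b, add_tmul _ _ _⟩
    rw [hT, RingHom.map_one, mul_one] at hz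
    obtain ⟨n, x, hx, rfl⟩ := Away.mk_surjective 𝒜 hs a
    refine Submodule.span_induction (p := fun b _ ↦ b ⊗ₜ[O] (1 : k) = 0) ?_ ?_ ?_ ?_
      (awayMk_mem_map_ker π φ hφ hs n x hx hz)
    · rintro _ ⟨o, ho, rfl⟩
      rw [Algebra.algebraMap_eq_smul_one, smul_tmul, Algebra.smul_def, mul_one]
      change (1 : Away 𝒜 s) ⊗ₜ[O] π o = 0
      rw [RingHom.mem_ker.mp ho, tmul_zero]
    · exact zero_tmul _ _
    · intro b b' _ _ hb hb'
      rw [add_tmul, hb, hb', add_zero]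
    · intro r b _ hb
      rw [smul_eq_mul, ← mul_one (1 : k), ← Algebra.TensorProduct.tmul_mul_tmul, hb, mul_zero]
  refine (CommRingCat.isPushout_tensorProduct O (Away 𝒜 s) k).of_iso (Iso.refl _) (Iso.refl _)
    (Iso.refl _) (RingEquiv.ofBijective T.toRingHom ⟨hinj, hsurj⟩).toCommRingCatIso (by simp)
    (by rfl) ?_ ?_
  · refine CommRingCat.hom_ext (RingHom.ext fun a ↦ ?_)
    change T (a ⊗ₜ 1) = Away.map φ s a
    rw [hT, RingHom.map_one, mul_one]
  · refine CommRingCat.hom_ext (RingHom.ext fun c ↦ ?_)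
    change T (1 ⊗ₜ c) = algebraMap k _ c
    rw [hT, RingHom.map_one, one_mul]

/-- On the chart `D₊(t) = Spec K[xᵢ]⁰_(t)` the structure morphism `Proj K[xᵢ] → Spec K[xᵢ]₀ → Spec K`
is `Spec` of the structure map `K → K[xᵢ]⁰_(t)` (Mathlib `Proj.awayι_toSpecZero`; any commutative
ring `K`). [folklore] -/
theorem awayι_toSpecZero_SpecMap {K : Type} [CommRing K] {t : MvPolynomial ι K} {d : ℕ}
    (ht : t ∈ homogeneousSubmodule ι K d) (hd : 0 < d) :
    Proj.awayι (homogeneousSubmodule ι K) t ht hd ≫ (Proj.toSpecZero (homogeneousSubmodule ι K) ≫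
      Spec.map (CommRingCat.ofHom (algebraMap K (homogeneousSubmodule ι K 0)))) =
      Spec.map (CommRingCat.ofHom (algebraMap K (Away (homogeneousSubmodule ι K) t))) := by
  rw [Proj.awayι_toSpecZero_assoc, ← Spec.map_comp, ← CommRingCat.ofHom_comp]

include hφ in
/-- **`ℙ(ι)_k = ℙ(ι)_O ×_{Spec O} Spec k` along a surjection `π : O → k`.** The square formed by
`Proj` of the base-change map `O[xᵢ] → k[xᵢ]` (Mathlib `Proj.map`), the structure morphisms and
`Spec π` is cartesian (Liu 2002, Prop. 3.1.9 with `B = O[xᵢ]`, `C = k`; Ex. 3.1.10): it suffices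
to check over the charts `D₊(s)` (Mathlib `Scheme.isPullback_of_openCover`, `Proj.awayι_comp_map`,
`Proj.map_preimage_basicOpen`), where it is `Spec` of `isPushout_awayMap`.
[cite: Liu2002, Prop. 3.1.9 and Ex. 3.1.10] -/
theorem isPullback_projMap (hπ : Function.Surjective π) (hφ' : ℬ₊ ≤ (𝒜₊).map φ) :
    IsPullback (Proj.map φ hφ')
      (Proj.toSpecZero ℬ ≫ Spec.map (CommRingCat.ofHom (algebraMap k (ℬ 0))))
      (Proj.toSpecZero 𝒜 ≫ Spec.map (CommRingCat.ofHom (algebraMap O (𝒜 0))))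
      (Spec.map (CommRingCat.ofHom π)) := by
  refine Scheme.isPullback_of_openCover _ _ _ _ (Proj.affineOpenCover 𝒜).openCover fun i ↦ ?_
  have hd : 0 < (i.1 : ℕ) := i.1.2
  have hs : (i.2 : MvPolynomial ι O) ∈ 𝒜 i.1 := i.2.2
  have hopen : IsPullback (Spec.map (CommRingCat.ofHom (Away.map φ (i.2 : MvPolynomial ι O))))
      (Proj.awayι ℬ (φ (i.2 : MvPolynomial ι O)) (φ.map_mem hs) hd)
      (Proj.awayι 𝒜 (i.2 : MvPolynomial ι O) hs hd) (Proj.map φ hφ') :=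
    IsOpenImmersion.isPullback _ _ _ _ (Proj.awayι_comp_map _ _ hd _ hs)
      (by rw [Proj.opensRange_awayι, Proj.opensRange_awayι, Proj.map_preimage_basicOpen])
  have hSpec := isPullback_SpecMap_of_isPushout _ _ _ _
    (isPushout_awayMap π φ hφ hπ (i.2 : MvPolynomial ι O) hs)
  refine hSpec.of_iso hopen.flip.isoPullback (Iso.refl _) (Iso.refl _) (Iso.refl _) ?_ ?_ ?_ ?_
  · exact (Category.comp_id _).trans hopen.flip.isoPullback_hom_snd.symm
  · exact (Category.comp_id _).trans ((awayι_toSpecZero_SpecMap (φ.map_mem hs) hd).symm.trans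
      ((congrArg (· ≫ (Proj.toSpecZero ℬ ≫ Spec.map (CommRingCat.ofHom (algebraMap k (ℬ 0)))))
        hopen.flip.isoPullback_hom_fst.symm).trans (Category.assoc _ _ _)))
  · exact (Category.comp_id _).trans
      ((awayι_toSpecZero_SpecMap hs hd).symm.trans (Category.id_comp _).symm)
  · simp

end ProjectiveAmbientFibre

/-- **STUB `stub_projectiveAmbientFibre` (known).** For a local ring `O` with a surjection `π : O → k`
onto a field and an integral closed subscheme `H ⊆ ℙⁿ_k`: the special fibre of `ℙⁿ_O → Spec O` is
irreducible (the image of `ℙⁿ_k = ℙⁿ_O ×_O k`, `ProjectiveAmbientFibre.isPullback_projMap`) and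
contains a closed subset `Y` whose reduced induced closed subscheme is isomorphic to `H` (the image
of `H` under the closed immersion `ℙⁿ_k → ℙⁿ_O`; a closed immersion from a reduced scheme has kernel
the vanishing ideal sheaf of its range). [cite: Liu2002, Prop. 3.1.9 and Ex. 3.1.10; see also Prop. 2.4.2] -/
theorem stub_projectiveAmbientFibre : ∀ (O : Type) [CommRing O] [IsLocalRing O] (k : Type) [Field k]
    (π : O →+* k), Function.Surjective π → ∀ (n : ℕ) (H : AlgebraicGeometry.Scheme.{0})
    (ι : H ⟶ (Literature.AlgebraicGeometry.Motives.projectiveSpace n k).left),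
    AlgebraicGeometry.IsClosedImmersion ι → AlgebraicGeometry.IsIntegral H →
    ∃ Y : TopologicalSpace.Closeds (Proj (MvPolynomial.homogeneousSubmodule (Fin (n + 1)) O)),
      (Y : Set (Proj (MvPolynomial.homogeneousSubmodule (Fin (n + 1)) O))) ⊆
        (Proj.toSpecZero (MvPolynomial.homogeneousSubmodule (Fin (n + 1)) O) ≫
          Spec.map (CommRingCat.ofHom (algebraMap O ((MvPolynomial.homogeneousSubmodule (Fin (n + 1)) O) 0)))) ⁻¹'
          {IsLocalRing.closedPoint O} ∧
      Nonempty ((AlgebraicGeometry.Scheme.IdealSheafData.vanishingIdeal Y).subscheme ≅ H) ∧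
      IsIrreducible ((Proj.toSpecZero (MvPolynomial.homogeneousSubmodule (Fin (n + 1)) O) ≫
          Spec.map (CommRingCat.ofHom (algebraMap O ((MvPolynomial.homogeneousSubmodule (Fin (n + 1)) O) 0)))) ⁻¹'
          {IsLocalRing.closedPoint O}) := by
  intro O _ _ k _ π hπ n H ι hι hH
  -- the graded base-change map `O[x] → k[x]` and the comparison `g : ℙⁿ_k ⟶ ℙⁿ_O`
  let φ : homogeneousSubmodule (Fin (n + 1)) O →+*ᵍ homogeneousSubmodule (Fin (n + 1)) k :=
    ⟨MvPolynomial.map π, fun h ↦ h.map π⟩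
  have hφ : ∀ p, φ p = MvPolynomial.map π p := fun _ ↦ rfl
  have hφ' := ProjectiveAmbientFibre.irrelevant_le_map_gradedMap π φ hφ
  have hP := ProjectiveAmbientFibre.isPullback_projMap π φ hφ hπ hφ'
  set q : Proj (homogeneousSubmodule (Fin (n + 1)) O) ⟶ Spec (.of O) :=
    Proj.toSpecZero (homogeneousSubmodule (Fin (n + 1)) O) ≫
      Spec.map (CommRingCat.ofHom (algebraMap O (homogeneousSubmodule (Fin (n + 1)) O 0)))
  set g : Proj (homogeneousSubmodule (Fin (n + 1)) k) ⟶ Proj (homogeneousSubmodule (Fin (n + 1)) O) :=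
    Proj.map φ hφ'
  -- `Spec k → Spec O` is a closed immersion onto the closed point, hence its base change `g` is a
  -- closed immersion onto the special fibre
  haveI : IsClosedImmersion (Spec.map (CommRingCat.ofHom π)) :=
    IsClosedImmersion.spec_of_surjective _ hπ
  haveI : IsClosedImmersion g :=
    MorphismProperty.IsStableUnderBaseChange.of_isPullback hP.flip inferInstance
  have hpt : ∀ x : Spec (.of k), Spec.map (CommRingCat.ofHom π) x = IsLocalRing.closedPoint O := by
    intro x
    rw [Spec.map_apply]
    apply PrimeSpectrum.ext
    rw [PrimeSpectrum.comap_asIdeal, CommRingCat.hom_ofHom, Ideal.eq_bot_of_prime x.asIdeal,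
      ← RingHom.ker_eq_comap_bot]
    exact IsLocalRing.eq_maximalIdeal (RingHom.ker_isMaximal_of_surjective π hπ)
  have hgq : ∀ x, q (g x) = IsLocalRing.closedPoint O := fun x ↦
    (Scheme.Hom.comp_apply g q x).symm.trans
      ((congrArg (fun h : Proj (homogeneousSubmodule (Fin (n + 1)) k) ⟶ Spec (.of O) ↦ h x)
        hP.w).trans ((Scheme.Hom.comp_apply _ _ x).trans (hpt _)))
  have hrange : Set.range g = q ⁻¹' {IsLocalRing.closedPoint O} := by
    refine Set.ext fun y ↦ ⟨?_, fun hy ↦ ?_⟩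
    · rintro ⟨x, rfl⟩
      exact hgq x
    · have hy' : q y = IsLocalRing.closedPoint O := hy
      obtain ⟨x, hx, -⟩ := Scheme.exists_preimage_of_isPullback hP y default
        (hy'.trans (hpt default).symm)
      exact ⟨x, hx⟩
  -- the closed immersion `f = ι ≫ g : H ⟶ ℙⁿ_O` and its range `Y`
  haveI := hH
  let ι' : H ⟶ Proj (homogeneousSubmodule (Fin (n + 1)) k) := ι
  haveI : IsClosedImmersion ι' := hι
  let f : H ⟶ Proj (homogeneousSubmodule (Fin (n + 1)) O) := ι' ≫ g
  let Y : Closeds (Proj (homogeneousSubmodule (Fin (n + 1)) O)) :=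
    ⟨Set.range f, f.isClosedEmbedding.isClosed_range⟩
  have hsub : Set.range f ⊆ Set.range g := by
    rintro _ ⟨x, rfl⟩
    exact ⟨ι' x, (Scheme.Hom.comp_apply _ _ x).symm⟩
  refine ⟨Y, hsub.trans hrange.subset, ?_, ?_⟩
  · -- `H` is reduced, so the kernel of the closed immersion `f` is the vanishing ideal sheaf of
    -- its range, which is also the kernel of `V(Y) ↪ ℙⁿ_O`
    have hYker : Scheme.IdealSheafData.vanishingIdeal Y = f.ker := by
      rw [← Scheme.IdealSheafData.map_bot, ← Scheme.nilradical_eq_bot,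
        ← Scheme.IdealSheafData.vanishingIdeal_top, Scheme.IdealSheafData.map_vanishingIdeal]
      congr 1
      ext1
      change Set.range f = closure (f '' Set.univ)
      rw [Set.image_univ, f.isClosedEmbedding.isClosed_range.closure_eq]
    have hker : (Scheme.IdealSheafData.vanishingIdeal Y).subschemeι.ker = f.ker := by
      rw [Scheme.IdealSheafData.ker_subschemeι, hYker]
    haveI := IsClosedImmersion.isIso_lift _ f hker
    exact ⟨(asIso (IsClosedImmersion.lift _ f hker.le)).symm⟩
  · -- the special fibre is the image of the irreducible `ℙⁿ_k`
    haveI :=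
      Literature.AlgebraicGeometry.Motives.ProjectiveSpace.geometricallyIrreducible_projToSpec n k
    haveI : IrreducibleSpace ↥(Proj (homogeneousSubmodule (Fin (n + 1)) k)) :=
      GeometricallyIrreducible.irreducibleSpace_of_subsingleton
        (f := Literature.AlgebraicGeometry.Motives.ProjBaseChange.projToSpec (Fin (n + 1)) k)
    have hirr : IsIrreducible (Set.range g) := by
      rw [← Set.image_univ]
      exact (IrreducibleSpace.isIrreducible_univ _).image _ g.continuous.continuousOn
    convert hirr using 1
    exact hrange.symm

end Summit.ResolutionOfSingularities.ResolutionOfSingularities.Cruxes.EquisingularLift.StrataSplit
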